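import Literature.MathematicalPhysics.QuantumFieldTheory.Balaban1983to89.T3UnitScaleTilt
import Literature.MathematicalPhysics.QuantumFieldTheory.Balaban1983to89.T3UnitLawDensityEML
import Literature.MathematicalPhysics.QuantumFieldTheory.Balaban1983to89.T4PairDerivBridge
import HarnessLib

/-!
# Route RevelationMartingale (line «revelation_martingale» on crux `HistoryTailL`, stmt-QuantumFields-19936) —
# PROXY ROWS ⇒ WINDOWED PREDICTABLE QUADRATIC VARIATION (the kernel face of the line's instrument row)

Cell `ym3-torus` (YM ladder rung R3 = continuum SU(2) Yang–Mills on the three-torus — a RUNG, NOT the Clay problem: not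
d = 4, not infinite volume, not a mass gap), width seat `ym-ust-19936-w3` gen 10; helper for the registered skeleton
`Cruxes/HistoryTailL/Lines/revelation_martingale.lean` (v3).  Nothing here proves a stub, the deciding crux
`SubGaussianRevelationL` (stmt-QuantumFields-23082), the crux `HistoryTailL`, or any summit statement.

WHAT.  The two bond-revelation stubs (`stub_levelOneBondRevelation`, `stub_higherBondRevelation`) and the route's
deciding crux ask for ADAPTED PROXIES `σ_i ≥ 0` with the conditional-MGF row
`E[exp(s·D_i) | ℱ_i] ≤ exp(s²σ_i/2)` a.s. for EVERY real `s` (`D_i = E[f|ℱ_(i+1)] − E[f|ℱ_i]` the Doob increments of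
`f = dist1(Ū^j(∂p))`) and `Σ_{i<n} σ_i ≤ Cv·g_(K−j)²` a.s. on the first-exit window `W`.  This file proves the
elementary NECESSARY CONDITION behind the line card's instrument row («`R_j(K)` … it is `Σ E σ_i/g²`»):

* §1 (pure probability, [folklore]) `condExp_sq_le_of_condExp_exp_mul_le`: if `|Y| ≤ b` a.e. and
  `E[exp(s·Y) | m] ≤ exp(s²σ/2)` a.e. for every real `s`, then `E[Y² | m] ≤ σ` a.e. — from the even minorant
  `2 + x² ≤ eˣ + e⁻ˣ` (tree: `NVector.two_add_sq_le_exp_add_exp_neg`, inlined) passed through the conditional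
  expectation at `s = 1/(n+1)`, `eᵘ − 1 ≤ u·eᵘ` (tree: `AreaLaw.exp_sub_one_le_mul_exp`, inlined), and `n → ∞`.
* §2 (any filtration) `sum_condExp_incr_sq_le_sum_proxy`: along a `Filtration ℕ`, the proxy rows for a bounded `f`
  give `Σ_{i<n} E[D_i² | ℱ_i] ≤ Σ_{i<n} σ_i` a.e.; `…_of_window` reads it on an event.
* §3 (the line's objects; route-independent — no `Theses` import) `windowedQV_gibbsK` (one cut-off, one plaquette,
  any filtration) and `windowedQV_of_bondRevelationOn` / `windowedQV_of_bondRevelation`: the PINNED bond-revelation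
  statement (any depth range `A K j → B K j →`; merged range `1 ≤ j ≤ K` = conclusion of the skeleton's
  `bondRevelation_of` = hypothesis of the landed `revelationMartingale_subGaussianRevelationL_of_bondRevelation`)
  implies, along THE bond-revelation filtration of the enumeration `e` it names, a.s. on `W`:
  `Σ_{i<N} E[D_i²|ℱ_i] ≤ Cv·γ·L^{−(K−j)}` — the quantity a nested Monte-Carlo run measures.  The BY-NAME reading for
  the route item `Theses.RevelationMartingale.SubGaussianRevelationL` is the sibling file
  `RevelationMartingaleWindowedQVOfSubGaussianRevelation.lean` (kept apart so that this file stays outside the route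
  cone).
  USE: a KILL handle — if the windowed predictable quadratic variation of the bond-revelation martingale divided by
  `g_(K−j)²` is unbounded in `K`, both registered bond stubs and every instance of 23082 along that filtration are dead;
  conversely nothing here is a step toward the stubs (the converse «variance proxy ⇒ sub-Gaussian MGF for all `s`» is
  false without further input).

Mathlib + tree only; def-free. [folklore]
-/

namespace Summit.QuantumFields.YangMills.Theorems.RevelationMartingaleProxyQV

open scoped BigOperators Classical MeasureTheory Topology
open Filter MeasureTheory

/-! ## §1  Sub-Gaussian conditional MGF for all `s` ⇒ conditional second moment ≤ proxy -/

section OneStep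

variable {Ω : Type*} {mΩ : MeasurableSpace Ω} {μ : Measure Ω}

/-- An a.e. bound `|Y| ≤ b` makes `exp (s·Y)` integrable on a finite measure space. [folklore] -/
theorem integrable_exp_mul_of_abs_le [IsFiniteMeasure μ] {Y : Ω → ℝ} (hYm : AEStronglyMeasurable Y μ) {b : ℝ}
    (hYb : ∀ᵐ ω ∂μ, |Y ω| ≤ b) (s : ℝ) : Integrable (fun ω => Real.exp (s * Y ω)) μ := by
  refine Integrable.of_bound (Real.continuous_exp.comp_aestronglyMeasurable (hYm.const_mul s))
    (Real.exp (|s| * b)) ?_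
  filter_upwards [hYb] with ω hω
  rw [Real.norm_eq_abs, abs_of_pos (Real.exp_pos _), Real.exp_le_exp]
  calc s * Y ω ≤ |s * Y ω| := le_abs_self _
    _ = |s| * |Y ω| := abs_mul s (Y ω)
    _ ≤ |s| * b := mul_le_mul_of_nonneg_left hω (abs_nonneg s)

/-- **SUB-GAUSSIAN CONDITIONAL MGF ⇒ CONDITIONAL VARIANCE PROXY.**  If `|Y| ≤ b` a.e. and, for EVERY real `s`,
`μ[exp(s·Y) ∣ m] ≤ exp(s²·σ/2)` a.e. (with `σ` any real function — in the use an `m`-measurable proxy), then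
`μ[Y² ∣ m] ≤ σ` a.e.  Proof: `2 + s²Y² ≤ e^{sY} + e^{−sY}` is passed through `μ[· ∣ m]`, giving
`s²·μ[Y²∣m] ≤ 2(e^{s²σ/2} − 1) ≤ s²σ·e^{s²σ/2}`; take `s = 1/(n+1)` (all `n` at once, a.e.) and let `n → ∞`.
QUANTIFIER ORDER (= the registered stubs' MGF row «`∀ s, ∀ᵐ ω`», `s` OUTSIDE the a.e.): the hypothesis is consumed for
each fixed `s` as an a.e. statement and only along the COUNTABLE two-sided family `s = ±1/(n+1)` (gathered by
`ae_all_iff`), so no joint-in-`s` null set is needed; `μ` finite (hence `μ.trim m` σ-finite), `m ≤ mΩ`.  This is the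
elementary necessary condition behind every «predictable variance proxy» hypothesis. [folklore] -/
theorem condExp_sq_le_of_condExp_exp_mul_le [IsFiniteMeasure μ] {Y : Ω → ℝ} (hYm : AEStronglyMeasurable Y μ)
    {b : ℝ} (hYb : ∀ᵐ ω ∂μ, |Y ω| ≤ b) {m : MeasurableSpace Ω} (hm : m ≤ mΩ) {σ : Ω → ℝ}
    (hmgf : ∀ s : ℝ, μ[fun ω => Real.exp (s * Y ω) | m] ≤ᵐ[μ] fun ω => Real.exp (s ^ 2 * σ ω / 2)) :
    μ[fun ω => Y ω ^ 2 | m] ≤ᵐ[μ] σ := by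
  have hY2i : Integrable (fun ω => Y ω ^ 2) μ := by
    refine Integrable.of_bound (hYm.pow 2) (b ^ 2) ?_
    filter_upwards [hYb] with ω hω
    rw [Real.norm_eq_abs, abs_pow, ← sq_abs b]
    exact pow_le_pow_left₀ (abs_nonneg _) (hω.trans (le_abs_self b)) 2
  have hexp := integrable_exp_mul_of_abs_le hYm hYb
  -- one value of `s ≠ 0`
  have hstep : ∀ s : ℝ, s ≠ 0 →
      ∀ᵐ ω ∂μ, (μ[fun ω => Y ω ^ 2 | m]) ω ≤ σ ω * Real.exp (s ^ 2 * σ ω / 2) := by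
    intro s hs
    have hpt : (fun _ => (2 : ℝ)) + (s ^ 2) • (fun ω => Y ω ^ 2) ≤ᵐ[μ]
        (fun ω => Real.exp (s * Y ω)) + (fun ω => Real.exp ((-s) * Y ω)) :=
      ae_of_all μ fun ω => by
        simp only [Pi.add_apply, Pi.smul_apply, smul_eq_mul]
        -- `2 + x² ≤ eˣ + e⁻ˣ` (first two terms of the `cosh` series), at `x = s·Y ω`
        have h : 2 + (s * Y ω) ^ 2 ≤ Real.exp (s * Y ω) + Real.exp (-(s * Y ω)) := by
          have hc := sum_le_hasSum (Finset.range 2)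
            (fun n _ => div_nonneg (by rw [pow_mul]; positivity) (Nat.cast_nonneg _))
            (Real.hasSum_cosh (s * Y ω))
          have h2 : 1 + (s * Y ω) ^ 2 / 2 ≤ Real.cosh (s * Y ω) := by
            simpa [Finset.sum_range_succ, Nat.factorial] using hc
          rw [Real.cosh_eq] at h2
          linarith
        rw [mul_pow] at h
        rwa [neg_mul]
    have hmono := condExp_mono (m := m) ((integrable_const (2 : ℝ)).add (hY2i.smul (s ^ 2)))
      ((hexp s).add (hexp (-s))) hpt
    have hadd1 := condExp_add (integrable_const (2 : ℝ)) (hY2i.smul (s ^ 2)) m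
    have hsm := condExp_smul (μ := μ) (s ^ 2) (fun ω => Y ω ^ 2) m
    have hadd2 := condExp_add (hexp s) (hexp (-s)) m
    have hmgf' := hmgf (-s)
    simp only [neg_sq] at hmgf'
    filter_upwards [hmono, hadd1, hsm, hadd2, hmgf s, hmgf'] with ω h1 h2 h3 h4 h5 h6
    have hL : (μ[(fun _ => (2 : ℝ)) + (s ^ 2) • (fun ω => Y ω ^ 2) | m]) ω
        = 2 + s ^ 2 * (μ[fun ω => Y ω ^ 2 | m]) ω := by
      rw [h2, Pi.add_apply, condExp_const hm (2 : ℝ), h3, Pi.smul_apply, smul_eq_mul]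
    have hR : (μ[(fun ω => Real.exp (s * Y ω)) + (fun ω => Real.exp ((-s) * Y ω)) | m]) ω
        ≤ 2 * Real.exp (s ^ 2 * σ ω / 2) := by
      rw [h4, Pi.add_apply]
      linarith [h5, h6]
    -- `eᵘ − 1 ≤ u·eᵘ` at `u = s²σ/2` (from `1 − u ≤ e⁻ᵘ`)
    have hu : Real.exp (s ^ 2 * σ ω / 2) - 1 ≤ s ^ 2 * σ ω / 2 * Real.exp (s ^ 2 * σ ω / 2) := by
      have h1 : -(s ^ 2 * σ ω / 2) + 1 ≤ Real.exp (-(s ^ 2 * σ ω / 2)) := Real.add_one_le_exp _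
      have hpos : 0 < Real.exp (s ^ 2 * σ ω / 2) := Real.exp_pos _
      have hmul := mul_le_mul_of_nonneg_right h1 hpos.le
      rw [← Real.exp_add, neg_add_cancel, Real.exp_zero] at hmul
      nlinarith [hmul, hpos]
    have hs2 : 0 < s ^ 2 := by positivity
    have key : s ^ 2 * (μ[fun ω => Y ω ^ 2 | m]) ω ≤ s ^ 2 * (σ ω * Real.exp (s ^ 2 * σ ω / 2)) := by
      have h7 : 2 + s ^ 2 * (μ[fun ω => Y ω ^ 2 | m]) ω ≤ 2 * Real.exp (s ^ 2 * σ ω / 2) := by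
        rw [← hL]; exact h1.trans hR
      nlinarith [h7, hu]
    exact le_of_mul_le_mul_left key hs2
  -- all `s = 1/(n+1)` at once, then `n → ∞`
  have hall : ∀ᵐ ω ∂μ, ∀ n : ℕ,
      (μ[fun ω => Y ω ^ 2 | m]) ω ≤ σ ω * Real.exp ((1 / ((n : ℝ) + 1)) ^ 2 * σ ω / 2) := by
    rw [ae_all_iff]
    intro n
    exact hstep _ (by positivity)
  filter_upwards [hall] with ω hω
  have h0 : Tendsto (fun n : ℕ => (1 / ((n : ℝ) + 1))) atTop (𝓝 0) := tendsto_one_div_add_atTop_nhds_zero_nat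
  have h1 : Tendsto (fun n : ℕ => (1 / ((n : ℝ) + 1)) ^ 2 * σ ω / 2) atTop (𝓝 ((0 : ℝ) ^ 2 * σ ω / 2)) :=
    ((h0.pow 2).mul_const _).div_const _
  rw [zero_pow two_ne_zero, zero_mul, zero_div] at h1
  have h2 : Tendsto (fun n : ℕ => Real.exp ((1 / ((n : ℝ) + 1)) ^ 2 * σ ω / 2)) atTop (𝓝 (Real.exp 0)) :=
    (Real.continuous_exp.tendsto 0).comp h1
  rw [Real.exp_zero] at h2
  have h3 : Tendsto (fun n : ℕ => σ ω * Real.exp ((1 / ((n : ℝ) + 1)) ^ 2 * σ ω / 2)) atTop (𝓝 (σ ω * 1)) :=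
    tendsto_const_nhds.mul h2
  rw [mul_one] at h3
  exact ge_of_tendsto' h3 hω

end OneStep

/-! ## §2  Along a filtration: the proxy rows dominate the predictable quadratic variation -/

section AlongFiltration

variable {Ω : Type*} {mΩ : MeasurableSpace Ω} {μ : Measure Ω} [IsFiniteMeasure μ]

/-- One index: the proxy row for the Doob increment `D_i = μ[f|ℱ (i+1)] − μ[f|ℱ i]` of a bounded `f` at EVERY real `s`
gives `μ[D_i² ∣ ℱ i] ≤ σ i` a.e. [folklore] -/
theorem condExp_incr_sq_le_proxy (ℱ : Filtration ℕ mΩ) {f : Ω → ℝ} {B : ℝ} (hfB : ∀ ω, |f ω| ≤ B)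
    {σ : ℕ → Ω → ℝ} (i : ℕ)
    (hmgf : ∀ s : ℝ, μ[fun ω => Real.exp (s * ((μ[f|ℱ (i + 1)]) ω - (μ[f|ℱ i]) ω)) | ℱ i]
      ≤ᵐ[μ] fun ω => Real.exp (s ^ 2 * σ i ω / 2)) :
    μ[fun ω => ((μ[f|ℱ (i + 1)]) ω - (μ[f|ℱ i]) ω) ^ 2 | ℱ i] ≤ᵐ[μ] σ i := by
  have hfB' : ∀ᵐ ω ∂μ, |f ω| ≤ B := Eventually.of_forall hfB
  have hDm : AEStronglyMeasurable (fun ω => (μ[f|ℱ (i + 1)]) ω - (μ[f|ℱ i]) ω) μ :=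
    ((stronglyMeasurable_condExp.mono (ℱ.le (i + 1))).sub
      (stronglyMeasurable_condExp.mono (ℱ.le i))).aestronglyMeasurable
  have hDb : ∀ᵐ ω ∂μ, |(μ[f|ℱ (i + 1)]) ω - (μ[f|ℱ i]) ω| ≤ B + B := by
    filter_upwards [ae_bdd_abs_condExp_of_ae_bdd_abs (m := ℱ (i + 1)) hfB',
      ae_bdd_abs_condExp_of_ae_bdd_abs (m := ℱ i) hfB'] with ω h1 h2
    exact (abs_sub _ _).trans (add_le_add h1 h2)
  exact condExp_sq_le_of_condExp_exp_mul_le hDm hDb (ℱ.le i) hmgf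

/-- **PROXY ROWS ⇒ PREDICTABLE QUADRATIC VARIATION.**  Along a filtration `ℱ : Filtration ℕ`, if the Doob increments of
a bounded `f` satisfy the sub-Gaussian conditional-MGF rows with proxies `σ i` at every real `s`, then a.e.
`Σ_{i<n} μ[D_i² ∣ ℱ i] ≤ Σ_{i<n} σ i`. [folklore] -/
theorem sum_condExp_incr_sq_le_sum_proxy (ℱ : Filtration ℕ mΩ) {f : Ω → ℝ} {B : ℝ} (hfB : ∀ ω, |f ω| ≤ B)
    {σ : ℕ → Ω → ℝ}
    (hmgf : ∀ (i : ℕ) (s : ℝ), μ[fun ω => Real.exp (s * ((μ[f|ℱ (i + 1)]) ω - (μ[f|ℱ i]) ω)) | ℱ i]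
      ≤ᵐ[μ] fun ω => Real.exp (s ^ 2 * σ i ω / 2)) (n : ℕ) :
    ∀ᵐ ω ∂μ, ∑ i ∈ Finset.range n, (μ[fun ω => ((μ[f|ℱ (i + 1)]) ω - (μ[f|ℱ i]) ω) ^ 2 | ℱ i]) ω
      ≤ ∑ i ∈ Finset.range n, σ i ω := by
  have hall : ∀ᵐ ω ∂μ, ∀ i ∈ Finset.range n,
      (μ[fun ω => ((μ[f|ℱ (i + 1)]) ω - (μ[f|ℱ i]) ω) ^ 2 | ℱ i]) ω ≤ σ i ω :=
    (eventually_all_finset (Finset.range n)).mpr fun i _ => condExp_incr_sq_le_proxy ℱ hfB i (hmgf i)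
  filter_upwards [hall] with ω hω
  exact Finset.sum_le_sum hω

/-- The same read on an event: if moreover `Σ_{i<n} σ i ≤ v` a.e. on `W`, then a.e. on `W` the predictable quadratic
variation is `≤ v`. [folklore] -/
theorem sum_condExp_incr_sq_le_of_window (ℱ : Filtration ℕ mΩ) {f : Ω → ℝ} {B : ℝ} (hfB : ∀ ω, |f ω| ≤ B)
    {σ : ℕ → Ω → ℝ}
    (hmgf : ∀ (i : ℕ) (s : ℝ), μ[fun ω => Real.exp (s * ((μ[f|ℱ (i + 1)]) ω - (μ[f|ℱ i]) ω)) | ℱ i]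
      ≤ᵐ[μ] fun ω => Real.exp (s ^ 2 * σ i ω / 2)) (n : ℕ) {W : Ω → Prop} {v : Ω → ℝ}
    (hwin : ∀ᵐ ω ∂μ, W ω → ∑ i ∈ Finset.range n, σ i ω ≤ v ω) :
    ∀ᵐ ω ∂μ, W ω → ∑ i ∈ Finset.range n, (μ[fun ω => ((μ[f|ℱ (i + 1)]) ω - (μ[f|ℱ i]) ω) ^ 2 | ℱ i]) ω
      ≤ v ω := by
  filter_upwards [sum_condExp_incr_sq_le_sum_proxy ℱ hfB hmgf n, hwin] with ω h1 h2 hW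
  exact h1.trans (h2 hW)

end AlongFiltration


/-! ## §3  The line's objects: windowed predictable quadratic variation under `gibbsK` -/

section Line

open Literature.MathematicalPhysics.QuantumFieldTheory.Balaban1983to89
  Literature.MathematicalPhysics.QuantumFieldTheory.Balaban1983to89.T3ContinuumYM3Torus
open Literature.MathematicalPhysics.QuantumFieldTheory.Balaban1983to89.T4PairDerivBridge
  (dist1_le_two_specialUnitaryGroup)

/-- The observable `f = dist1(Ū^j(∂p))` is bounded: `|f| ≤ 2`. [folklore] -/
theorem abs_dist1_iter_plaqHol_le_two (F : T3Family) (K j : ℕ) (p : Plaq (F.P K) j) (V : GaugeField (F.P K) 0 (Matrix.specialUnitaryGroup (Fin 2) ℂ)) :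
    |GaugeGroup.dist1 (GaugeField.plaqHol
        (Averaging.iter (fun i => BlockAveraging.blockAvg (P := F.P K) (j := i) T3UnitLawDensityEML.ℰp) j V) p)| ≤ 2 := by
  rw [abs_of_nonneg (GaugeGroup.dist1_nonneg _)]
  exact dist1_le_two_specialUnitaryGroup _

/-- **WINDOWED PREDICTABLE QUADRATIC VARIATION under `gibbsK` (one cut-off, one plaquette, any filtration).**  If along a
filtration `ℱ` of the cut-off-`K` configuration space the Doob increments of `dist1(Ū^j(∂p))` obey the proxy rows
(`∀ s`) and the proxies sum to `≤ v` on an event `W`, then a.e. on `W` the predictable quadratic variation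
`Σ_{i<n} E[D_i² | ℱ i]` is `≤ v`. [folklore] -/
theorem windowedQV_gibbsK (F : T3Family) {γ : ℝ} (hγ : 0 ≤ γ) (K j : ℕ) (p : Plaq (F.P K) j)
    (ℱ : MeasureTheory.Filtration ℕ (inferInstance : MeasurableSpace (GaugeField (F.P K) 0 (Matrix.specialUnitaryGroup (Fin 2) ℂ))))
    {σ : ℕ → GaugeField (F.P K) 0 (Matrix.specialUnitaryGroup (Fin 2) ℂ) → ℝ} {n : ℕ} {W : GaugeField (F.P K) 0 (Matrix.specialUnitaryGroup (Fin 2) ℂ) → Prop} {v : GaugeField (F.P K) 0 (Matrix.specialUnitaryGroup (Fin 2) ℂ) → ℝ}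
    (hmgf : (∀ (i : ℕ) (s : ℝ), ∀ᵐ U ∂(T3UnitScaleTilt.gibbsK F T3UnitLawDensityEML.ℰp γ K),
          MeasureTheory.condExp (ℱ i) (T3UnitScaleTilt.gibbsK F T3UnitLawDensityEML.ℰp γ K)
            (fun U' => Real.exp (s *
              (MeasureTheory.condExp (ℱ (i + 1)) (T3UnitScaleTilt.gibbsK F T3UnitLawDensityEML.ℰp γ K)
                  (fun V => GaugeGroup.dist1 (GaugeField.plaqHol
            (Averaging.iter (fun i => BlockAveraging.blockAvg (P := F.P K) (j := i) T3UnitLawDensityEML.ℰp) j V) p)) U' -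
               MeasureTheory.condExp (ℱ i) (T3UnitScaleTilt.gibbsK F T3UnitLawDensityEML.ℰp γ K)
                  (fun V => GaugeGroup.dist1 (GaugeField.plaqHol
            (Averaging.iter (fun i => BlockAveraging.blockAvg (P := F.P K) (j := i) T3UnitLawDensityEML.ℰp) j V) p)) U'))) U
            ≤ Real.exp (s ^ 2 * σ i U / 2)))
    (hwin : ∀ᵐ U ∂(T3UnitScaleTilt.gibbsK F T3UnitLawDensityEML.ℰp γ K), W U → ∑ i ∈ Finset.range n, σ i U ≤ v U) :
    ∀ᵐ U ∂(T3UnitScaleTilt.gibbsK F T3UnitLawDensityEML.ℰp γ K), W U →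
      ∑ i ∈ Finset.range n, MeasureTheory.condExp (ℱ i) (T3UnitScaleTilt.gibbsK F T3UnitLawDensityEML.ℰp γ K)
            (fun U' => (MeasureTheory.condExp (ℱ (i + 1)) (T3UnitScaleTilt.gibbsK F T3UnitLawDensityEML.ℰp γ K)
                  (fun V => GaugeGroup.dist1 (GaugeField.plaqHol
            (Averaging.iter (fun i => BlockAveraging.blockAvg (P := F.P K) (j := i) T3UnitLawDensityEML.ℰp) j V) p)) U' -
               MeasureTheory.condExp (ℱ i) (T3UnitScaleTilt.gibbsK F T3UnitLawDensityEML.ℰp γ K)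
                  (fun V => GaugeGroup.dist1 (GaugeField.plaqHol
            (Averaging.iter (fun i => BlockAveraging.blockAvg (P := F.P K) (j := i) T3UnitLawDensityEML.ℰp) j V) p)) U') ^ 2) U ≤ v U := by
  haveI := T3UnitScaleTilt.isProbabilityMeasure_gibbsK F T3UnitLawDensityEML.ℰp hγ K
  exact sum_condExp_incr_sq_le_of_window ℱ (abs_dist1_iter_plaqHol_le_two F K j p) hmgf n hwin

/-- **PINNED BOND REVELATION ⇒ WINDOWED PREDICTABLE QUADRATIC VARIATION ALONG THE BOND FILTRATION (any depth
range).**  For an arbitrary depth side-condition `A K j → B K j →` (the registered stubs use `j = 1 → 1 ≤ K →` and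
`2 ≤ j → j ≤ K →`; their merge `bondRevelation_of` uses `1 ≤ j → j ≤ K →`): the pinned bond-revelation statement on
that range implies that along THE bond-revelation filtration of the enumeration `e` it names (every `ℱ` with `ℱ i` =
pull-back under the masked revelation map), a.e. on the first-exit window,
`Σ_{i<N} E[D_i² | ℱ i] ≤ Cv·γ·L^{−(K−j)}` — the K-uniform bound a nested Monte-Carlo estimate of the bond-revelation
martingale's windowed predictable quadratic variation must exhibit if the stub is true (the line card's instrument row,
kernel face).  A NECESSARY condition only. [folklore] -/
theorem windowedQV_of_bondRevelationOn (A B : ℕ → ℕ → Prop)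
    (h : ∀ (L : ℕ) (b₀ p₀ b₂ : ℝ), 0 < b₀ → 2 < p₀ → b₀ ≤ b₂ → ∃ (γ₁ Cv : ℝ), 0 < γ₁ ∧ γ₁ ≤ 1 ∧ 0 < Cv ∧
      ∀ (F : T3Family) (γ : ℝ), F.L = L → 0 < γ → γ ≤ γ₁ → ∀ (K j : ℕ), A K j → B K j → ∀ p : Plaq (F.P K) j,
      ∃ (N : ℕ) (e : Fin N → PBond (F.P K) 0), Function.Surjective e ∧
        ∀ ℱ : MeasureTheory.Filtration ℕ (inferInstance : MeasurableSpace (GaugeField (F.P K) 0 (Matrix.specialUnitaryGroup (Fin 2) ℂ))),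
          (∀ i, ℱ i = MeasurableSpace.comap
          (fun (U : GaugeField (F.P K) 0 (Matrix.specialUnitaryGroup (Fin 2) ℂ)) (m : Fin N) =>
            if (m : ℕ) < i then U (e m) else (1 : Matrix.specialUnitaryGroup (Fin 2) ℂ)) inferInstance) →
        ∃ σ : ℕ → GaugeField (F.P K) 0 (Matrix.specialUnitaryGroup (Fin 2) ℂ) → ℝ,
          (∀ i, StronglyMeasurable[ℱ i] (σ i)) ∧
          (∀ i U, 0 ≤ σ i U) ∧
          (∀ (i : ℕ) (s : ℝ), ∀ᵐ U ∂(T3UnitScaleTilt.gibbsK F T3UnitLawDensityEML.ℰp γ K),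
          MeasureTheory.condExp (ℱ i) (T3UnitScaleTilt.gibbsK F T3UnitLawDensityEML.ℰp γ K)
            (fun U' => Real.exp (s *
              (MeasureTheory.condExp (ℱ (i + 1)) (T3UnitScaleTilt.gibbsK F T3UnitLawDensityEML.ℰp γ K)
                  (fun V => GaugeGroup.dist1 (GaugeField.plaqHol
            (Averaging.iter (fun i => BlockAveraging.blockAvg (P := F.P K) (j := i) T3UnitLawDensityEML.ℰp) j V) p)) U' -
               MeasureTheory.condExp (ℱ i) (T3UnitScaleTilt.gibbsK F T3UnitLawDensityEML.ℰp γ K)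
                  (fun V => GaugeGroup.dist1 (GaugeField.plaqHol
            (Averaging.iter (fun i => BlockAveraging.blockAvg (P := F.P K) (j := i) T3UnitLawDensityEML.ℰp) j V) p)) U'))) U
            ≤ Real.exp (s ^ 2 * σ i U / 2)) ∧
          (∀ᵐ U ∂(T3UnitScaleTilt.gibbsK F T3UnitLawDensityEML.ℰp γ K),
            ((∀ k, k < j → PlaqSmall (T3UnitScaleTilt.θBal F.L γ b₀ p₀ (K - k))
            (Averaging.iter (fun i => BlockAveraging.blockAvg (P := F.P K) (j := i) T3UnitLawDensityEML.ℰp) k U)) ∧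
          PlaqSmall (T3UnitScaleTilt.θBal F.L γ b₂ p₀ (K - j))
            (Averaging.iter (fun i => BlockAveraging.blockAvg (P := F.P K) (j := i) T3UnitLawDensityEML.ℰp) j U)) →
            ∑ i ∈ Finset.range N, σ i U ≤ Cv * (γ * ((F.L : ℝ)⁻¹) ^ (K - j)))) :
    ∀ (L : ℕ) (b₀ p₀ b₂ : ℝ), 0 < b₀ → 2 < p₀ → b₀ ≤ b₂ → ∃ (γ₁ Cv : ℝ), 0 < γ₁ ∧ γ₁ ≤ 1 ∧ 0 < Cv ∧
      ∀ (F : T3Family) (γ : ℝ), F.L = L → 0 < γ → γ ≤ γ₁ → ∀ (K j : ℕ), A K j → B K j → ∀ p : Plaq (F.P K) j,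
      ∃ (N : ℕ) (e : Fin N → PBond (F.P K) 0), Function.Surjective e ∧
        ∀ ℱ : MeasureTheory.Filtration ℕ (inferInstance : MeasurableSpace (GaugeField (F.P K) 0 (Matrix.specialUnitaryGroup (Fin 2) ℂ))),
          (∀ i, ℱ i = MeasurableSpace.comap
          (fun (U : GaugeField (F.P K) 0 (Matrix.specialUnitaryGroup (Fin 2) ℂ)) (m : Fin N) =>
            if (m : ℕ) < i then U (e m) else (1 : Matrix.specialUnitaryGroup (Fin 2) ℂ)) inferInstance) →
          ∀ᵐ U ∂(T3UnitScaleTilt.gibbsK F T3UnitLawDensityEML.ℰp γ K),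
            ((∀ k, k < j → PlaqSmall (T3UnitScaleTilt.θBal F.L γ b₀ p₀ (K - k))
            (Averaging.iter (fun i => BlockAveraging.blockAvg (P := F.P K) (j := i) T3UnitLawDensityEML.ℰp) k U)) ∧
          PlaqSmall (T3UnitScaleTilt.θBal F.L γ b₂ p₀ (K - j))
            (Averaging.iter (fun i => BlockAveraging.blockAvg (P := F.P K) (j := i) T3UnitLawDensityEML.ℰp) j U)) →
            ∑ i ∈ Finset.range N, MeasureTheory.condExp (ℱ i) (T3UnitScaleTilt.gibbsK F T3UnitLawDensityEML.ℰp γ K)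
            (fun U' => (MeasureTheory.condExp (ℱ (i + 1)) (T3UnitScaleTilt.gibbsK F T3UnitLawDensityEML.ℰp γ K)
                  (fun V => GaugeGroup.dist1 (GaugeField.plaqHol
            (Averaging.iter (fun i => BlockAveraging.blockAvg (P := F.P K) (j := i) T3UnitLawDensityEML.ℰp) j V) p)) U' -
               MeasureTheory.condExp (ℱ i) (T3UnitScaleTilt.gibbsK F T3UnitLawDensityEML.ℰp γ K)
                  (fun V => GaugeGroup.dist1 (GaugeField.plaqHol
            (Averaging.iter (fun i => BlockAveraging.blockAvg (P := F.P K) (j := i) T3UnitLawDensityEML.ℰp) j V) p)) U') ^ 2) U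
              ≤ Cv * (γ * ((F.L : ℝ)⁻¹) ^ (K - j)) := by
  intro L b₀ p₀ b₂ hb₀ hp₀ hb₂
  obtain ⟨γ₁, Cv, hγ₁, hγ₁1, hCv, hF⟩ := h L b₀ p₀ b₂ hb₀ hp₀ hb₂
  refine ⟨γ₁, Cv, hγ₁, hγ₁1, hCv, fun F γ hL hγ hγle K j hA hB p => ?_⟩
  obtain ⟨N, e, he, hAll⟩ := hF F γ hL hγ hγle K j hA hB p
  refine ⟨N, e, he, fun ℱ hℱ => ?_⟩
  obtain ⟨σ, _hσm, _hσ0, hmgf, hwin⟩ := hAll ℱ hℱ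
  exact windowedQV_gibbsK F hγ.le K j p ℱ hmgf hwin

/-- The same on the merged depth range `1 ≤ j ≤ K`: the hypothesis is VERBATIM the hypothesis of the landed
`revelationMartingale_subGaussianRevelationL_of_bondRevelation` (= the conclusion of the skeleton's `bondRevelation_of`).
[folklore] -/
theorem windowedQV_of_bondRevelation
    (h : ∀ (L : ℕ) (b₀ p₀ b₂ : ℝ), 0 < b₀ → 2 < p₀ → b₀ ≤ b₂ → ∃ (γ₁ Cv : ℝ), 0 < γ₁ ∧ γ₁ ≤ 1 ∧ 0 < Cv ∧
      ∀ (F : T3Family) (γ : ℝ), F.L = L → 0 < γ → γ ≤ γ₁ → ∀ (K j : ℕ), 1 ≤ j → j ≤ K → ∀ p : Plaq (F.P K) j,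
      ∃ (N : ℕ) (e : Fin N → PBond (F.P K) 0), Function.Surjective e ∧
        ∀ ℱ : MeasureTheory.Filtration ℕ (inferInstance : MeasurableSpace (GaugeField (F.P K) 0 (Matrix.specialUnitaryGroup (Fin 2) ℂ))),
          (∀ i, ℱ i = MeasurableSpace.comap
          (fun (U : GaugeField (F.P K) 0 (Matrix.specialUnitaryGroup (Fin 2) ℂ)) (m : Fin N) =>
            if (m : ℕ) < i then U (e m) else (1 : Matrix.specialUnitaryGroup (Fin 2) ℂ)) inferInstance) →
        ∃ σ : ℕ → GaugeField (F.P K) 0 (Matrix.specialUnitaryGroup (Fin 2) ℂ) → ℝ,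
          (∀ i, StronglyMeasurable[ℱ i] (σ i)) ∧
          (∀ i U, 0 ≤ σ i U) ∧
          (∀ (i : ℕ) (s : ℝ), ∀ᵐ U ∂(T3UnitScaleTilt.gibbsK F T3UnitLawDensityEML.ℰp γ K),
          MeasureTheory.condExp (ℱ i) (T3UnitScaleTilt.gibbsK F T3UnitLawDensityEML.ℰp γ K)
            (fun U' => Real.exp (s *
              (MeasureTheory.condExp (ℱ (i + 1)) (T3UnitScaleTilt.gibbsK F T3UnitLawDensityEML.ℰp γ K)
                  (fun V => GaugeGroup.dist1 (GaugeField.plaqHol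
            (Averaging.iter (fun i => BlockAveraging.blockAvg (P := F.P K) (j := i) T3UnitLawDensityEML.ℰp) j V) p)) U' -
               MeasureTheory.condExp (ℱ i) (T3UnitScaleTilt.gibbsK F T3UnitLawDensityEML.ℰp γ K)
                  (fun V => GaugeGroup.dist1 (GaugeField.plaqHol
            (Averaging.iter (fun i => BlockAveraging.blockAvg (P := F.P K) (j := i) T3UnitLawDensityEML.ℰp) j V) p)) U'))) U
            ≤ Real.exp (s ^ 2 * σ i U / 2)) ∧
          (∀ᵐ U ∂(T3UnitScaleTilt.gibbsK F T3UnitLawDensityEML.ℰp γ K),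
            ((∀ k, k < j → PlaqSmall (T3UnitScaleTilt.θBal F.L γ b₀ p₀ (K - k))
            (Averaging.iter (fun i => BlockAveraging.blockAvg (P := F.P K) (j := i) T3UnitLawDensityEML.ℰp) k U)) ∧
          PlaqSmall (T3UnitScaleTilt.θBal F.L γ b₂ p₀ (K - j))
            (Averaging.iter (fun i => BlockAveraging.blockAvg (P := F.P K) (j := i) T3UnitLawDensityEML.ℰp) j U)) →
            ∑ i ∈ Finset.range N, σ i U ≤ Cv * (γ * ((F.L : ℝ)⁻¹) ^ (K - j)))) :
    ∀ (L : ℕ) (b₀ p₀ b₂ : ℝ), 0 < b₀ → 2 < p₀ → b₀ ≤ b₂ → ∃ (γ₁ Cv : ℝ), 0 < γ₁ ∧ γ₁ ≤ 1 ∧ 0 < Cv ∧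
      ∀ (F : T3Family) (γ : ℝ), F.L = L → 0 < γ → γ ≤ γ₁ → ∀ (K j : ℕ), 1 ≤ j → j ≤ K → ∀ p : Plaq (F.P K) j,
      ∃ (N : ℕ) (e : Fin N → PBond (F.P K) 0), Function.Surjective e ∧
        ∀ ℱ : MeasureTheory.Filtration ℕ (inferInstance : MeasurableSpace (GaugeField (F.P K) 0 (Matrix.specialUnitaryGroup (Fin 2) ℂ))),
          (∀ i, ℱ i = MeasurableSpace.comap
          (fun (U : GaugeField (F.P K) 0 (Matrix.specialUnitaryGroup (Fin 2) ℂ)) (m : Fin N) =>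
            if (m : ℕ) < i then U (e m) else (1 : Matrix.specialUnitaryGroup (Fin 2) ℂ)) inferInstance) →
          ∀ᵐ U ∂(T3UnitScaleTilt.gibbsK F T3UnitLawDensityEML.ℰp γ K),
            ((∀ k, k < j → PlaqSmall (T3UnitScaleTilt.θBal F.L γ b₀ p₀ (K - k))
            (Averaging.iter (fun i => BlockAveraging.blockAvg (P := F.P K) (j := i) T3UnitLawDensityEML.ℰp) k U)) ∧
          PlaqSmall (T3UnitScaleTilt.θBal F.L γ b₂ p₀ (K - j))
            (Averaging.iter (fun i => BlockAveraging.blockAvg (P := F.P K) (j := i) T3UnitLawDensityEML.ℰp) j U)) →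
            ∑ i ∈ Finset.range N, MeasureTheory.condExp (ℱ i) (T3UnitScaleTilt.gibbsK F T3UnitLawDensityEML.ℰp γ K)
            (fun U' => (MeasureTheory.condExp (ℱ (i + 1)) (T3UnitScaleTilt.gibbsK F T3UnitLawDensityEML.ℰp γ K)
                  (fun V => GaugeGroup.dist1 (GaugeField.plaqHol
            (Averaging.iter (fun i => BlockAveraging.blockAvg (P := F.P K) (j := i) T3UnitLawDensityEML.ℰp) j V) p)) U' -
               MeasureTheory.condExp (ℱ i) (T3UnitScaleTilt.gibbsK F T3UnitLawDensityEML.ℰp γ K)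
                  (fun V => GaugeGroup.dist1 (GaugeField.plaqHol
            (Averaging.iter (fun i => BlockAveraging.blockAvg (P := F.P K) (j := i) T3UnitLawDensityEML.ℰp) j V) p)) U') ^ 2) U
              ≤ Cv * (γ * ((F.L : ℝ)⁻¹) ^ (K - j)) :=
  windowedQV_of_bondRevelationOn (fun _ j => 1 ≤ j) (fun K j => j ≤ K) h

end Line

end Summit.QuantumFields.YangMills.Theorems.RevelationMartingaleProxyQV
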